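import Summits.BirchSwinnertonDyer.Rank1Residual.X2.NonPrimitiveLambdaInvariantOfDatum
import Summits.BirchSwinnertonDyer.Rank1Residual.X2.GreenbergVatsalTateDatumCofree
import Literature.NumberTheory.EllipticCurves.GreenbergVatsal2000.NonPrimitiveLambdaInvariantMultiplicative
import HarnessLib

/-!
# GV (6)–(7) at an odd NON-SPLIT multiplicative prime DERIVED: the non-split half of the record
# `GreenbergVatsal2000.lambda_nonPrimitive_eq_add_sum_delta_multiplicative` (registry A133) from the
# datum record `datumSelmer_nonPrimitive_invariants` (T-GV23L) and the twisted Tate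
# uniformisation (A41) — and the exact location of the SPLIT gap

HONEST FRAMING (BSD rank-`≤ 1` residual cell `b2b-bsdres`, home
`run/shared/lean/b2b/bsd-rank1-residual/`, unit `b2b-bsdres-eisenstein-p2`, class X2; research route,
no claim beyond stated classes): the cell deletes the COMBINATION-SHAPED residual classes of the
rank-`≤ 1` BSD formula from PUBLISHED theorems only and TYPES the construction-shaped ones; this is
not "finishing BSD". THEOREMS ONLY (no definition, no named fact, nothing asserted, nothing booked).

## What

GV pp. 14–15: "we will treat the case where `E` has multiplicative reduction at `p`. If `E` has
nonsplit multiplicative reduction at `p`, then the arguments described in the introduction go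
through almost unchanged." In the kernel: at an odd NON-SPLIT `p ‖ N` the classical Selmer groups
over `ℚ_∞` ARE Greenberg–Vatsal's datum groups for the (twisted) Tate datum — there is no trivial
zero: `greenbergKer = strictKer = localKerOver` at the place above `p`
(`GreenbergVatsalTateDatumCofree.exists_data_of_not_split`, from A41 = Silverman ATAEC V.5.3/5.4,
`hT'`), and the LINK at every `v ∤ p` incl. bad ones (team n1011 / p06,
`Additive.selmerInfty_eq_datumSelmerInfty`, `Additive.nonPrimitiveSelmerInfty_eq_datumSelmerInfty`).
The Tate line `C ≅ μ_{p^∞} ⊗ φ` is divisible with `#C[p] = p` (same theorem) and `E(ℚ_∞)[p^∞]` is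
finite (`finite_fixedPoints_kerSubgroup_of_hasMultiplicativeReductionAtPrime`, from A41). So the
datum record `datumSelmer_nonPrimitive_invariants` (`h23`), read through the transport of
`NonPrimitiveLambdaInvariantOfDatum` §1, gives the conclusion of A133 VERBATIM at every non-split
odd `p ‖ N`:

* `lambda_nonPrimitive_eq_add_sum_delta_multiplicative_of_not_split` — `h23 → A41 →` (A133's
  binders) `→ ¬ split → DS.X` f.g. and `Λ`-torsion, `μ(DS.X) = μ(D.X)`,
  `λ(DS.X) = λ(D.X) + Σ_{v∈Σ₀} δ_E^{(v)}`.

## The SPLIT gap (located, not closed here)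

At a SPLIT `p ‖ N` the classical groups are the STRICT ones (`Sel^{Σ₀}_E(ℚ_∞)_p = S^{Σ₀,str}_A(ℚ_∞)`,
`NonPrimitiveSelmerStrictEquality.exists_data_nonPrimitiveSelmerInfty_eq_of_split`) and
`S^{Σ₀}_A/S^{Σ₀,str}_A ↪ D ≅ ℚ_p/ℤ_p` (`GreenbergVatsalStrictAtSplit`). Writing `M₀`, `M` for the
images of `S^{Σ₀}_A`, `S_A` in `ℚ_p/ℤ_p` (each either finite or everything), the datum record gives
`λ(S^{Σ₀,str}) + rk M₀^ = λ(S^{str}) + rk M^ + Σ δ`, so A133 at a split prime is EQUIVALENT (given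
`h23`) to `rk M₀^ = rk M^`, i.e. to "`M` infinite whenever `M₀` is". The tree's trivial-zero record
A137 (`datumStrictSelmer_lt_datumSelmer_of_split`) says only `M ≠ 0` (and only under `S_A[p]`
finite), which does not exclude `M` finite, `M₀ = ℚ_p/ℤ_p`; what pins `M = ℚ_p/ℤ_p` in print is the
finite-cokernel clause of GV Prop. (2.1)'s proof (p. 20: "`γ'₀` … has finite cokernel. In fact, the
kernel of `γ'₀` is the strict Selmer group") — `S_A/S^{str}_A` has finite index in
`H¹_{ur}((ℚ_∞)_𝔭, D) ≅ ℚ_p/ℤ_p`, hence is all of it. A record of THAT consequence ("`S^{str}_A(ℚ_∞)`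
has infinite index in `S_A(ℚ_∞)` at a split prime", same page, same hypotheses as Prop. (2.1))
would make the split half derivable exactly as below and would imply A137; this file does not
state it (a literature-seat decision).

References: R. Greenberg, V. Vatsal, Invent. Math. 142 (2000) = arXiv:math/9906215, §1 (5)–(7)
pp. 7–8, pp. 14–15, §2 Prop. (2.1) p. 17 and its proof p. 20, Cor. (2.3), Prop. (2.4) pp. 20–22,
p. 26, Remark (2.10) p. 27; J. Silverman, ATAEC (1994) Ch. V Lemma 5.2, Thm. 5.3, Cor. 5.4;
R. Greenberg, LNM 1716 (1999) §1 p. 62, §2 p. 76, §3 p. 86, p. 93.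
-/

noncomputable section

open scoped Classical AddSubgroup

namespace Summit.BirchSwinnertonDyer.Rank1Residual.X2.NonPrimitiveLambdaInvariantMultiplicativeOfDatum

open NumberField IsDedekindDomain Field WeierstrassCurve
  Literature.NumberTheory.EllipticCurves Literature.NumberTheory.EllipticCurves.GreenbergSelmer
  Literature.NumberTheory.EllipticCurves.GreenbergVatsal2000
  Literature.NumberTheory.GaloisRepresentations
  Summit.BirchSwinnertonDyer.Rank1Residual.X2.GreenbergVatsalTateDatumCofree
  Summit.BirchSwinnertonDyer.Rank1Residual.X2.GreenbergVatsalTransferMultiplicative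
  Summit.BirchSwinnertonDyer.Rank1Residual.X2.NonPrimitiveLambdaInvariantOfDatum

/-- **GV (6)–(7) at an odd NON-SPLIT `p ‖ N`, DERIVED** — the conclusion of
`lambda_nonPrimitive_eq_add_sum_delta_multiplicative` (A133) verbatim, for a prime of NON-split
multiplicative reduction, from the datum record (`h23`) and the twisted Tate uniformisation (`hT'`,
A41). GV pp. 14–15: "If `E` has nonsplit multiplicative reduction at `p`, then the arguments
described in the introduction go through almost unchanged"; p. 26's specialisation (classical
groups = datum groups, `H⁰(ℚ_∞, A*)` finite) is done in the kernel for the Tate datum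
(`exists_data_of_not_split`: `C` divisible, `#C[p] = p`, `greenbergKer = strictKer`,
`localKerOver ≤ strictKer ≤ localKerOver`; the `v ∤ p` LINK of team n1011).
[cite: GreenbergVatsal2000, §1 (5)–(7) pp. 7–8; pp. 14–15; §2 Cor. (2.3), Prop. (2.4) (pp. 20–22); p. 26; Remark (2.10)]
[cite: SilvermanATAEC1994, Ch. V Lemma 5.2 (c), Thm. 5.3 (a),(b), Cor. 5.4] -/
theorem lambda_nonPrimitive_eq_add_sum_delta_multiplicative_of_not_split
    (h23 : datumSelmer_nonPrimitive_invariants)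
    (hT' : Silverman1994_thmV53_corV54_tateUniformisation.{0})
    (W : WeierstrassCurve ℚ) [W.IsElliptic] [W.IsGloballyMinimal] (p : ℕ) [Fact p.Prime]
    (hp2 : p ≠ 2) (hmult : W.HasMultiplicativeReductionAtPrime p)
    (hns : ¬ W.HasSplitMultiplicativeReductionAtPrime p)
    (κ : ZpExtension ℚ p) (hκ : κ.IsCyclotomic) (γ : absoluteGaloisGroup ℚ)
    (hγ : κ.IsTopGenerator γ) (S₀ : Finset (HeightOneSpectrum (𝓞 ℚ)))
    (hS₀ : ∀ v ∈ S₀, ((p : ℕ) : 𝓞 ℚ) ∉ v.asIdeal)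
    (D : W.SelmerDualData κ γ) [Module.Finite (IwasawaAlgebra p) D.X]
    (DS : NonPrimitiveDualData W κ γ (↑S₀ : Set (HeightOneSpectrum (𝓞 ℚ))))
    (hX : D.IsTorsion) :
    Module.Finite (IwasawaAlgebra p) DS.X ∧ Module.IsTorsion (IwasawaAlgebra p) DS.X ∧
      muInvariant p DS.X = muInvariant p D.X ∧
      lambdaInvariant p DS.X = lambdaInvariant p D.X + ∑ v ∈ S₀, delta W p v := by
  -- the Tate data above `p` with all its properties (A41)
  obtain ⟨L, -, -, hC, hgs, hls, hsl⟩ := exists_data_of_not_split W p κ hT' hκ hp2 hmult hns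
  have hRD : ∀ (v : HeightOneSpectrum (𝓞 ℚ)) (hv : ((p : ℕ) : 𝓞 ℚ) ∈ v.asIdeal),
      (L v hv).greenbergKer κ.kerSubgroup = W.localKerOver p κ.kerSubgroup (v.adicCompletion ℚ) :=
    fun v hv ↦ (hgs v hv).trans (le_antisymm (hsl v hv) (hls v hv))
  have hA : Finite (FixedPoints.addSubgroup κ.kerSubgroup (W.geomPrimaryTorsion p)) :=
    finite_fixedPoints_kerSubgroup_of_hasMultiplicativeReductionAtPrime W p hT' hp2 hmult κ hκ
  -- classical = datum, primitive and non-primitive (bad places outside `Σ₀` allowed)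
  have hSel : W.selmerInfty κ = datumSelmerInfty κ (W.geomPrimaryTorsion p) L ∅ :=
    Additive.selmerInfty_eq_datumSelmerInfty W p κ hp2 hκ L hRD
  have hNP : nonPrimitiveSelmerInfty W κ (↑S₀ : Set (HeightOneSpectrum (𝓞 ℚ))) =
      datumSelmerInfty κ (W.geomPrimaryTorsion p) L (↑S₀ : Set (HeightOneSpectrum (𝓞 ℚ))) :=
    Additive.nonPrimitiveSelmerInfty_eq_datumSelmerInfty W p κ _ hp2 hκ L hRD
      (fun v hv ↦ hS₀ v (Finset.mem_coe.1 hv))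
  -- transport the duals, read the datum record, transport back
  obtain ⟨X, ⟨eX⟩⟩ := exists_datumDualData_of_selmerDualData W D hSel
  obtain ⟨X₀, ⟨eX₀⟩⟩ := exists_datumDualData_of_nonPrimitiveDualData W DS hNP
  haveI : Module.Finite (IwasawaAlgebra p) X.X := Module.Finite.equiv eX.symm
  have hXt : Module.IsTorsion (IwasawaAlgebra p) X.X :=
    isTorsion_of_injective eX.toLinearMap eX.injective hX
  obtain ⟨hfg, htors, hμ, hlam, -⟩ := h23 W p hp2 κ hκ γ hγ L hC hA S₀ hS₀ X X₀ hXt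
  haveI := hfg
  refine ⟨Module.Finite.equiv eX₀, isTorsion_of_injective eX₀.symm.toLinearMap eX₀.symm.injective htors,
    ?_, ?_⟩
  · rw [← muInvariant_eq_of_linearEquiv eX₀, hμ, muInvariant_eq_of_linearEquiv eX]
  · rw [← lambdaInvariant_eq_of_linearEquiv eX₀, hlam, lambdaInvariant_eq_of_linearEquiv eX]

end Summit.BirchSwinnertonDyer.Rank1Residual.X2.NonPrimitiveLambdaInvariantMultiplicativeOfDatum

end
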